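import Summits.BirchSwinnertonDyer.BirchSwinnertonDyer.Theorems.SignedLowerHalvesSmallImageLowerHalfBothSignsValveFloor
import Summits.BirchSwinnertonDyer.Rank1Residual.Additive.PlusSymbolIntegrality
import HarnessLib

/-!
# Route `SignedLowerHalves`, crux L `SmallImageLowerHalfBothSigns` (item stmt-BirchSwinnertonDyer-23599), line `rtt_w3` — crux idea `valve`:
# DEPLETION PRESERVES A UNIT ω⁰-ORBIT SUM, and the REVERSE valve (a unit orbit sum of `W` ⟹ brick B1 for the partner)

Width seat `bsd-line-slh-p3-w3` g15 under LEAD `cruxlead-stmt-BirchSwinnertonDyer-23599` (cell `bsd-ssimc`); ROUTE-INDEPENDENT helper (`--supports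
stmt-BirchSwinnertonDyer-23599`); THEOREMS ONLY (no definition, no named fact, no `sorry`); closes nothing; BSD / crux L / crux M are proved for NO
curve by this. Companion of `…ValveDepletion` (brick B2) on the ω⁰ BRANCH, same Ihara-free road (annihilator lemma of `…ValveDepletionAlgebra` + the
ORBIT-SUM recursion at `p` with `a_p = 0`, tree `TeichSpan.intCast_mul_teichOrbitSum_succ`). §1 `sum_teichOrbitSum_fibre_eq_neg`
(`Σ_{b ↦ a} S_f(p,n+2,b) = −S_f(p,n,ā)`), `isUnit_of_natCast_val_eq`, propagation `exists_unit_norm_teichOrbitSum_eq_one_add_two[_mul]`,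
`card_filter_castHom_eq`. §2 ★ `exists_norm_depletedOrbitSum_eq_one`: a unit orbit sum `‖S_f(p,m,u)‖ = 1` (`m ≥ 1`) forces a unit DEPLETED orbit
sum `‖Σ_k (∏_i [X^{k_i}]P_i ℓ_i^{−k_i})·S_f(p,n,(∏ℓ_i^{k_i})·b)‖ = 1` (`n ≥ 1`; any family `ℓ_i > 1` prime to `p`, `P_i ∈ ℤ[X]`, `P_i(0) = 1`).
§3 ★ `orbitUnitCert_of_norm_teichOrbitSum_eq_one` — the REVERSE valve: with the Vatsal OUTPUT at a depleted pair `(f₁, g₁)` and the Euler-factor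
family depletion identity, a unit orbit sum of `W`'s newform gives brick B1 for `g₁` with `c = 1` (`‖ι⁻¹(Ωf/Ω⁺_f)‖ ≤ 1` because `[·]⁺_f` is integral
at EVERY cusp when `W[p]` is irreducible, tree `norm_ratPlusSymbol_le_one_of_irreducible`). With `…ValveFloor.muOneSign_body_of_orbitUnitCert`:
B1 for the partner ⟺ a unit ω⁰-orbit sum of `f` at a level `≥ 1`, modulo the K-chain's Vatsal output.
References: [MazurTateTeitelbaum1986Invent] §I.4 (4.2), §I.10; [Vatsal1999] Thm. (1.13), Rem. (1.12); [GreenbergVatsal2000] §1 (8)–(9).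
-/

set_option autoImplicit false
-- D-0017: single-problem summit, the namespace repeats the problem name by design.
set_option linter.dupNamespace false
noncomputable section
open scoped Classical MatrixGroups ModularForm
open Polynomial CongruenceSubgroup Literature.NumberTheory.EllipticCurves Literature.NumberTheory.EllipticCurves.ModularForms
  Literature.NumberTheory.EllipticCurves.Rank1Residual Literature.NumberTheory.GaloisRepresentations
  Summit.BirchSwinnertonDyer.BirchSwinnertonDyer.Theorems.SmallImageHeckePrimeMu

namespace Summit.BirchSwinnertonDyer.BirchSwinnertonDyer.Theorems.SmallImageValve

open Summit.BirchSwinnertonDyer.BirchSwinnertonDyer.Cruxes.AnalyticMuZeroX9.TeichSpan (intCast_mul_teichOrbitSum_succ)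
open Summit.BirchSwinnertonDyer.BirchSwinnertonDyer.Theorems.SmallImageTeichOrbitMu (norm_teichOrbitSum_le_one)

variable {p : ℕ} [hp : Fact p.Prime] {N : ℕ} [NeZero N] {W : WeierstrassCurve ℚ} [W.IsElliptic] [W.IsGloballyMinimal]
  {f : CuspForm (Gamma0 N) 2}

/-! ## §1 The orbit-sum recursion at `p` with `a_p = 0`; lifts; propagation; fibres -/

/-- **Orbit-sum fibre relation** (`a_p(W) = 0`, `n ≥ 1`): `Σ_{b ↦ a} S_f(p, n+2, b) = −S_f(p, n, ā)` over the `p` lifts `b ∈ ℤ/p^{n+2}` of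
`a ∈ ℤ/p^{n+1}`. [cite: MazurTateTeitelbaum1986Invent, §I.4 (4.2) and §I.10 (10.2)] -/
theorem sum_teichOrbitSum_fibre_eq_neg (hp2 : p ≠ 2) (hf : IsNewformOf W f) (hgood : W.HasGoodReductionAtPrime p)
    (hap : W.frobeniusTrace p = 0) {n : ℕ} (hn : 1 ≤ n) (a : ZMod (p ^ (n + 1))) :
    ∑ b ∈ Finset.univ.filter (fun b : ZMod (p ^ (n + 2)) ↦
        ZMod.castHom (pow_dvd_pow p (n + 1).le_succ) (ZMod (p ^ (n + 1))) b = a), teichOrbitSum f p (n + 2) b =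
      - teichOrbitSum f p n (ZMod.castHom (pow_dvd_pow p n.le_succ) (ZMod (p ^ n)) a) := by
  have hpN : ¬ p ∣ N := not_dvd_level_of_isNewformOf hf hgood
  have hap' : cuspCoeff f p = ((0 : ℤ) : ℂ) := by rw [cuspCoeff_eq_frobeniusTrace_of_isNewformOf_holds hf hgood, hap]
  have h := intCast_mul_teichOrbitSum_succ hf.1 hpN hap' (ratCast_ratPlusSymbol_holds hf.1 hf.coeffField_eq_bot) hp2 hn a
  rw [Int.cast_zero, zero_mul, eq_comm, add_eq_zero_iff_eq_neg] at h
  exact h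

omit [NeZero N] in
/-- A class of `ℤ/p^k` lying over a UNIT of `ℤ/p^m` (`m ≥ 1`) is a unit. [folklore] -/
theorem isUnit_of_natCast_val_eq {k m : ℕ} (hm : 1 ≤ m) (b : ZMod (p ^ k)) (u : (ZMod (p ^ m))ˣ)
    (h : ((b.val : ℕ) : ZMod (p ^ m)) = (u : ZMod (p ^ m))) : IsUnit b := by
  haveI : NeZero (p ^ k) := ⟨pow_ne_zero _ hp.out.ne_zero⟩
  rw [← ZMod.natCast_zmod_val b, ZMod.isUnit_iff_coprime]
  refine Nat.Coprime.pow_right _ ((Nat.Prime.coprime_iff_not_dvd hp.out).mpr fun hdvd ↦ ?_).symm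
  -- `p ∣ b.val` contradicts `b.val ≡ u (mod p^m)` with `u` a unit
  have hu : (u : ZMod (p ^ m)).val.Coprime (p ^ m) := ZMod.val_coe_unit_coprime u
  have hval : (u : ZMod (p ^ m)).val = b.val % p ^ m := by rw [← h, ZMod.val_natCast]
  have hpu : p ∣ (u : ZMod (p ^ m)).val := by
    rw [hval]; exact (Nat.dvd_mod_iff (dvd_pow_self p (by omega))).mpr hdvd
  have := Nat.Coprime.coprime_dvd_right (dvd_pow_self p (by omega)) hu
  exact hp.out.ne_one ((Nat.coprime_comm.mp this).eq_one_of_dvd hpu)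

/-- **Propagation `m → m + 2` of unit orbit sums** (`m ≥ 1`, `a_p(W) = 0`): a unit `S_f(p,m,u)` forces a unit `S_f(p,m+2,u')` for some lift
`u'` (fibre relation + ultrametric inequality + integrality of orbit sums). [cite: MazurTateTeitelbaum1986Invent, §I.4 (4.2)] -/
theorem exists_unit_norm_teichOrbitSum_eq_one_add_two (hp2 : p ≠ 2) (hf : IsNewformOf W f) (hgood : W.HasGoodReductionAtPrime p)
    (hap : W.frobeniusTrace p = 0) {m : ℕ} (hm : 1 ≤ m)
    (h : ∃ u : (ZMod (p ^ m))ˣ, ‖((teichOrbitSum f p m (u : ZMod (p ^ m)) : ℚ) : ℚ_[p])‖ = 1) :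
    ∃ u : (ZMod (p ^ (m + 2)))ˣ, ‖((teichOrbitSum f p (m + 2) (u : ZMod (p ^ (m + 2))) : ℚ) : ℚ_[p])‖ = 1 := by
  obtain ⟨u, hu⟩ := h
  have hpN : ¬ p ∣ N := not_dvd_level_of_isNewformOf hf hgood
  have hap' : cuspCoeff f p = ((0 : ℤ) : ℂ) := by rw [cuspCoeff_eq_frobeniusTrace_of_isNewformOf_holds hf hgood, hap]
  haveI : ∀ j : ℕ, NeZero (p ^ j) := fun j ↦ ⟨pow_ne_zero _ hp.out.ne_zero⟩
  set a : ZMod (p ^ (m + 1)) := (((u : ZMod (p ^ m)).val : ℕ) : ZMod (p ^ (m + 1))) with ha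
  have hau : ZMod.castHom (pow_dvd_pow p m.le_succ) (ZMod (p ^ m)) a = (u : ZMod (p ^ m)) := by
    rw [ha, map_natCast, ZMod.natCast_zmod_val]
  have hfib := sum_teichOrbitSum_fibre_eq_neg hp2 hf hgood hap hm a
  rw [hau] at hfib
  -- the fibre is nonempty
  set F := Finset.univ.filter (fun b : ZMod (p ^ (m + 2)) ↦
    ZMod.castHom (pow_dvd_pow p (m + 1).le_succ) (ZMod (p ^ (m + 1))) b = a) with hF
  have hne : F.Nonempty := ⟨(((u : ZMod (p ^ m)).val : ℕ) : ZMod (p ^ (m + 2))), by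
    rw [hF, Finset.mem_filter]; exact ⟨Finset.mem_univ _, by rw [map_natCast]⟩⟩
  obtain ⟨b, hb, hle⟩ := IsUltrametricDist.exists_norm_finsetSum_le_of_nonempty hne
    (fun b ↦ ((teichOrbitSum f p (m + 2) b : ℚ) : ℚ_[p]))
  have hnorm : ‖((teichOrbitSum f p (m + 2) b : ℚ) : ℚ_[p])‖ = 1 := by
    refine le_antisymm (norm_teichOrbitSum_le_one f hp2 hf.1 hpN hap' _ _) ?_
    rw [← hu, ← norm_neg, ← Rat.cast_neg, ← hfib, Rat.cast_sum]
    exact hle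
  -- `b` is a unit
  have hbF := (Finset.mem_filter.mp hb).2
  have hbu : IsUnit b := by
    refine isUnit_of_natCast_val_eq (p := p) hm b u ?_
    have h1 : ZMod.castHom (pow_dvd_pow p (m + 1).le_succ) (ZMod (p ^ (m + 1))) b = ((b.val : ℕ) : ZMod (p ^ (m + 1))) := by
      rw [ZMod.castHom_apply, ZMod.cast_eq_val]
    have h2 := congrArg (ZMod.castHom (pow_dvd_pow p m.le_succ) (ZMod (p ^ m))) hbF
    rw [h1, map_natCast, hau] at h2
    exact h2
  exact ⟨hbu.unit, by rw [IsUnit.unit_spec]; exact hnorm⟩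

/-- Propagation iterated: `m → m + 2k`. [cite: MazurTateTeitelbaum1986Invent, §I.4 (4.2)] -/
theorem exists_unit_norm_teichOrbitSum_eq_one_add_two_mul (hp2 : p ≠ 2) (hf : IsNewformOf W f)
    (hgood : W.HasGoodReductionAtPrime p) (hap : W.frobeniusTrace p = 0) {m : ℕ} (hm : 1 ≤ m)
    (h : ∃ u : (ZMod (p ^ m))ˣ, ‖((teichOrbitSum f p m (u : ZMod (p ^ m)) : ℚ) : ℚ_[p])‖ = 1) (k : ℕ) :
    ∃ u : (ZMod (p ^ (m + 2 * k)))ˣ, ‖((teichOrbitSum f p (m + 2 * k) (u : ZMod (p ^ (m + 2 * k))) : ℚ) : ℚ_[p])‖ = 1 := by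
  induction k with
  | zero => simpa using h
  | succ k ih =>
    have := exists_unit_norm_teichOrbitSum_eq_one_add_two hp2 hf hgood hap (m := m + 2 * k) (by omega) ih
    rw [show m + 2 * (k + 1) = m + 2 * k + 2 by ring]
    exact this

omit [NeZero N] in
/-- **Every fibre of `ℤ/p^{k+1} → ℤ/p^k` has `p` elements** (the lifts of `a` are `a.val + p^k j`, `j < p`). [folklore] -/
theorem card_filter_castHom_eq (k : ℕ) (a : ZMod (p ^ k)) :
    (Finset.univ.filter (fun b : ZMod (p ^ (k + 1)) ↦ ZMod.castHom (pow_dvd_pow p k.le_succ) (ZMod (p ^ k)) b = a)).card = p := by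
  haveI : ∀ j : ℕ, NeZero (p ^ j) := fun j ↦ ⟨pow_ne_zero _ hp.out.ne_zero⟩
  have hlt : ∀ j : Fin p, a.val + p ^ k * (j : ℕ) < p ^ (k + 1) := fun j ↦
    calc a.val + p ^ k * (j : ℕ) < p ^ k * ((j : ℕ) + 1) := by have := ZMod.val_lt a; rw [mul_add, mul_one]; omega
      _ ≤ p ^ k * p := Nat.mul_le_mul_left _ j.isLt
      _ = p ^ (k + 1) := by rw [pow_succ]
  have himage : Finset.univ.filter (fun b : ZMod (p ^ (k + 1)) ↦ ZMod.castHom (pow_dvd_pow p k.le_succ) (ZMod (p ^ k)) b = a) =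
      Finset.univ.image (fun j : Fin p ↦ ((a.val + p ^ k * (j : ℕ) : ℕ) : ZMod (p ^ (k + 1)))) := by
    ext b
    simp only [Finset.mem_filter, Finset.mem_univ, true_and, Finset.mem_image]
    constructor
    · intro hb
      rw [ZMod.castHom_apply, ZMod.cast_eq_val] at hb
      have hmod : b.val % p ^ k = a.val := by
        have := congrArg ZMod.val hb
        rwa [ZMod.val_natCast] at this
      have hdiv : b.val / p ^ k < p :=
        Nat.div_lt_of_lt_mul (lt_of_lt_of_eq (ZMod.val_lt b) (pow_succ p k))
      refine ⟨⟨b.val / p ^ k, hdiv⟩, ?_⟩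
      have : a.val + p ^ k * (b.val / p ^ k) = b.val := by rw [← hmod]; exact Nat.mod_add_div _ _
      rw [this, ZMod.natCast_zmod_val]
    · rintro ⟨j, rfl⟩
      rw [map_natCast, Nat.cast_add, ZMod.natCast_zmod_val, Nat.cast_mul, ZMod.natCast_self, zero_mul, add_zero]
  rw [himage, Finset.card_image_of_injective _ fun j j' hjj' ↦ ?_, Finset.card_univ, Fintype.card_fin]
  have h := congrArg ZMod.val hjj'
  simp only [ZMod.val_natCast_of_lt (hlt _)] at h
  have hp0 : 0 < p ^ k := pow_pos hp.out.pos _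
  exact Fin.ext (Nat.eq_of_mul_eq_mul_left hp0 (by omega))

/-! ## §2 Depletion preserves a unit ω⁰-orbit sum -/

/-- ★ **`S₀`-depletion preserves a unit Teichmüller ω⁰-orbit sum** (`W/ℚ`, newform `f`, `p` odd supersingular good, `a_p = 0`; integers
`ℓ_i > 1` prime to `p`, `P_i ∈ ℤ[X]`, `P_i(0) = 1`): a unit orbit sum `S_f(p, m, u)` (`m ≥ 1`, `u` a unit) forces a unit DEPLETED orbit sum
`Σ_k (∏_i [X^{k_i}]P_i·ℓ_i^{−k_i}) · S_f(p, n, (∏_i ℓ_i^{k_i})·b)` (`n ≥ 1`, `b` a unit). Road: propagate to a large level of the same parity; if all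
depleted orbit sums at level `M + 2` were non-units, `u ↦ S_f(p, M+2, u) mod p` would be killed by the depletion operator, hence constant on the
fibres of `ℤ/p^{M+2} → ℤ/p^{M+1}` (`p` elements each), so every fibre sum vanishes mod `p` — contradicting `sum_teichOrbitSum_fibre_eq_neg`.
[cite: MazurTateTeitelbaum1986Invent, §I.4 (4.2) and §I.10 (10.1)] [cite: GreenbergVatsal2000, §1 (8)–(9)] -/
theorem exists_norm_depletedOrbitSum_eq_one (hp2 : p ≠ 2) (hf : IsNewformOf W f) (hgood : W.HasGoodReductionAtPrime p)
    (hap : W.frobeniusTrace p = 0) {ι : Type*} [Fintype ι] [DecidableEq ι] (ℓ : ι → ℕ) (hℓ : ∀ i, 1 < ℓ i ∧ ¬ p ∣ ℓ i)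
    (P : ι → ℤ[X]) (hP0 : ∀ i, (P i).coeff 0 = 1) {m : ℕ} (hm : 1 ≤ m)
    (h : ∃ u : (ZMod (p ^ m))ˣ, ‖((teichOrbitSum f p m (u : ZMod (p ^ m)) : ℚ) : ℚ_[p])‖ = 1) :
    ∃ n : ℕ, 1 ≤ n ∧ ∃ b : (ZMod (p ^ n))ˣ,
      ‖((∑ k ∈ Fintype.piFinset (fun _ : ι ↦ Finset.range 3),
          (∏ i, ((P i).coeff (k i) : ℚ) * ((ℓ i : ℚ) ^ (k i))⁻¹) *
            teichOrbitSum f p n (((∏ i, ℓ i ^ (k i) : ℕ) : ZMod (p ^ n)) * (b : ZMod (p ^ n))) : ℚ) : ℚ_[p])‖ = 1 := by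
  have hp' := hp.out
  have hpN : ¬ p ∣ N := not_dvd_level_of_isNewformOf hf hgood
  have hap' : cuspCoeff f p = ((0 : ℤ) : ℂ) := by rw [cuspCoeff_eq_frobeniusTrace_of_isNewformOf_holds hf hgood, hap]
  -- parameters and the propagated unit orbit sum at level `M = m + 2(w + b₀)`
  set b₀ : ℕ := 2 * Fintype.card ι with hb₀
  have hbp : 2 * Fintype.card ι ≤ p ^ b₀ := (Nat.lt_two_pow_self).le.trans (Nat.pow_le_pow_left hp'.two_le _)
  set w : ℕ := ∑ i, padicValNat p (ℓ i ^ (p ^ 2 - 1) - 1) with hw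
  have hwi : ∀ i, padicValNat p (ℓ i ^ (p ^ 2 - 1) - 1) ≤ w := fun i ↦
    Finset.single_le_sum (f := fun i ↦ padicValNat p (ℓ i ^ (p ^ 2 - 1) - 1)) (fun _ _ ↦ Nat.zero_le _) (Finset.mem_univ i)
  obtain ⟨u₁, hu₁⟩ := exists_unit_norm_teichOrbitSum_eq_one_add_two_mul hp2 hf hgood hap hm h (w + b₀)
  generalize hM : m + 2 * (w + b₀) = M at u₁ hu₁
  have hM1 : 1 ≤ M := by omega
  haveI : ∀ j : ℕ, NeZero (p ^ j) := fun j ↦ ⟨pow_ne_zero _ hp'.ne_zero⟩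
  by_contra hcon
  push Not at hcon
  -- integrality of orbit sums and of the coefficients
  have hintO : ∀ a : ZMod (p ^ (M + 2)), ‖((teichOrbitSum f p (M + 2) a : ℚ) : ℚ_[p])‖ ≤ 1 :=
    fun a ↦ norm_teichOrbitSum_le_one f hp2 hf.1 hpN hap' _ _
  have hcoef : ∀ i (j : ℕ), ‖((((P i).coeff j : ℚ) * ((ℓ i : ℚ) ^ j)⁻¹ : ℚ) : ℚ_[p])‖ ≤ 1 := by
    intro i j
    have hℓ1 : ‖((ℓ i : ℕ) : ℚ_[p])‖ = 1 :=
      Padic.norm_natCast_eq_one_iff.mpr ((Nat.Prime.coprime_iff_not_dvd hp').mpr (hℓ i).2)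
    rw [Rat.cast_mul, Rat.cast_inv, Rat.cast_pow, Rat.cast_natCast, Rat.cast_intCast, norm_mul, norm_inv, norm_pow, hℓ1, one_pow,
      inv_one, mul_one]
    exact Padic.norm_int_le_one _
  -- units `σ_i = ℓ_i mod p^{M+2}` and the mod-`p` Euler factors
  have hcop : ∀ i, (ℓ i).Coprime (p ^ (M + 2)) := fun i ↦ (((Nat.Prime.coprime_iff_not_dvd hp').mpr (hℓ i).2).symm).pow_right _
  set σ : ι → (ZMod (p ^ (M + 2)))ˣ := fun i ↦ ZMod.unitOfCoprime (ℓ i) (hcop i) with hσdef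
  have hσ : ∀ i, (σ i : ZMod (p ^ (M + 2))) = ℓ i := fun i ↦ ZMod.coe_unitOfCoprime _ _
  set q : ι → ℕ → ℤ_[p] := fun i j ↦ ⟨((((P i).coeff j : ℚ) * ((ℓ i : ℚ) ^ j)⁻¹ : ℚ) : ℚ_[p]), hcoef i j⟩ with hqdef
  set Q : ι → (ZMod p)[X] := fun i ↦
    C (PadicInt.toZMod (q i 2)) * X ^ 2 + C (PadicInt.toZMod (q i 1)) * X + C (PadicInt.toZMod (q i 0)) with hQdef
  have hQdeg : ∀ i, (Q i).natDegree ≤ 2 := fun i ↦ natDegree_quadratic_le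
  have hQcoeff : ∀ i, ∀ j < 3, (Q i).coeff j = PadicInt.toZMod (q i j) := by
    intro i j hj
    interval_cases j <;> simp [hQdef, coeff_X, coeff_C, coeff_X_pow]
  have hQ0 : ∀ i, (Q i).coeff 0 ≠ 0 := by
    intro i
    have h1 : q i 0 = 1 := PadicInt.ext (by simp [hqdef, hP0 i])
    rw [hQcoeff i 0 (by norm_num), h1, map_one]
    exact one_ne_zero
  have hker : ∀ x : ℤ_[p], PadicInt.toZMod x = 0 ↔ ‖x‖ < 1 := fun x ↦ by
    rw [← RingHom.mem_ker, PadicInt.ker_toZMod, IsLocalRing.mem_maximalIdeal, PadicInt.mem_nonunits]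
  -- the function `c(u) = S_f(p, M+2, u) mod p`
  set XO : ZMod (p ^ (M + 2)) → ℤ_[p] := fun a ↦ ⟨((teichOrbitSum f p (M + 2) a : ℚ) : ℚ_[p]), hintO a⟩ with hXO
  set c : (ZMod (p ^ (M + 2)))ˣ → ZMod p := fun u ↦ PadicInt.toZMod (XO (u : ZMod (p ^ (M + 2)))) with hcdef
  have hXcoe : ∀ a, ((XO a : ℤ_[p]) : ℚ_[p]) = ((teichOrbitSum f p (M + 2) a : ℚ) : ℚ_[p]) := fun a ↦ rfl
  have hqcoe : ∀ i (j : ℕ), ((q i j : ℤ_[p]) : ℚ_[p]) = ((((P i).coeff j : ℚ) * ((ℓ i : ℚ) ^ j)⁻¹ : ℚ) : ℚ_[p]) := fun i j ↦ rfl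
  -- all depleted orbit sums at level `M + 2` are non-units ⟹ hypothesis of the annihilator lemma
  have hc : ∀ u : (ZMod (p ^ (M + 2)))ˣ, ∑ k ∈ Fintype.piFinset (fun _ : ι ↦ Finset.range 3),
      (∏ i, (Q i).coeff (k i)) * c ((∏ i, σ i ^ (k i)) * u) = 0 := by
    intro u
    have hk : ∀ k ∈ Fintype.piFinset (fun _ : ι ↦ Finset.range 3),
        (∏ i, (Q i).coeff (k i)) * c ((∏ i, σ i ^ (k i)) * u) =
          PadicInt.toZMod ((∏ i, q i (k i)) * XO (((∏ i, σ i ^ (k i)) * u : (ZMod (p ^ (M + 2)))ˣ) : ZMod (p ^ (M + 2)))) := by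
      intro k hk
      rw [map_mul, map_prod]
      congr 1
      exact Finset.prod_congr rfl fun i _ ↦ hQcoeff i (k i) (Finset.mem_range.mp (Fintype.mem_piFinset.mp hk i))
    rw [Finset.sum_congr rfl hk, ← map_sum, hker]
    have hval : ∀ k : ι → ℕ, (((∏ i, q i (k i)) * XO (((∏ i, σ i ^ (k i)) * u : (ZMod (p ^ (M + 2)))ˣ) : ZMod (p ^ (M + 2))) :
        ℤ_[p]) : ℚ_[p]) =
        (((∏ i, ((P i).coeff (k i) : ℚ) * ((ℓ i : ℚ) ^ (k i))⁻¹) *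
          teichOrbitSum f p (M + 2) (((∏ i, ℓ i ^ (k i) : ℕ) : ZMod (p ^ (M + 2))) * (u : ZMod (p ^ (M + 2)))) : ℚ) : ℚ_[p]) := by
      intro k
      have hprod : (((∏ i, q i (k i) : ℤ_[p])) : ℚ_[p]) = ∏ i, ((q i (k i) : ℤ_[p]) : ℚ_[p]) := by
        simp [← PadicInt.Coe.ringHom_apply, map_prod PadicInt.Coe.ringHom]
      have hu : (((∏ i, σ i ^ (k i)) * u : (ZMod (p ^ (M + 2)))ˣ) : ZMod (p ^ (M + 2))) =
          ((∏ i, ℓ i ^ (k i) : ℕ) : ZMod (p ^ (M + 2))) * (u : ZMod (p ^ (M + 2))) := by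
        push_cast; simp only [hσ]
      rw [PadicInt.coe_mul, hprod, Rat.cast_mul, Rat.cast_prod, hXcoe, hu]
    have h1 : ‖(∑ k ∈ Fintype.piFinset (fun _ : ι ↦ Finset.range 3),
        (∏ i, q i (k i)) * XO (((∏ i, σ i ^ (k i)) * u : (ZMod (p ^ (M + 2)))ˣ) : ZMod (p ^ (M + 2))) : ℤ_[p])‖ ≤ 1 :=
      PadicInt.norm_le_one _
    rw [PadicInt.norm_def, PadicInt.coe_sum, Finset.sum_congr rfl fun k _ ↦ hval k, ← Rat.cast_sum] at h1 ⊢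
    exact lt_of_le_of_ne h1 (hcon (M + 2) (by omega) u)
  -- the annihilator lemma: `c` is constant on the fibres `{b₁ + t p^{M+1}}`
  have hL2 : b₀ + 2 ≤ M + 2 := by omega
  have hLi : ∀ i, padicValNat p (ℓ i ^ (p ^ 2 - 1) - 1) + b₀ + 1 ≤ M + 2 := fun i ↦ by have := hwi i; omega
  have hcop₁ : ((u₁ : ZMod (p ^ M)).val).Coprime (p ^ (M + 2)) :=
    (((ZMod.val_coe_unit_coprime u₁).coprime_dvd_right (dvd_pow_self p (by omega))).pow_right _)
  set b₁ : (ZMod (p ^ (M + 2)))ˣ := ZMod.unitOfCoprime _ hcop₁ with hb₁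
  have hb₁val : (b₁ : ZMod (p ^ (M + 2))) = (((u₁ : ZMod (p ^ M)).val : ℕ) : ZMod (p ^ (M + 2))) := ZMod.coe_unitOfCoprime _ _
  have hfibc : ∀ t : ℕ, ∃ u : (ZMod (p ^ (M + 2)))ˣ,
      (u : ZMod (p ^ (M + 2))) = b₁ + t * (p : ZMod (p ^ (M + 2))) ^ (M + 2 - 1) ∧ c u = c b₁ := fun t ↦
    exists_unit_eq_add_mul_and_apply_eq hp2 ℓ hℓ σ hσ Q hQdeg hQ0 hbp hL2 hLi c hc b₁ t
  -- the fibre of `a = u₁ mod p^{M+1}` in `ℤ/p^{M+2}`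
  set a : ZMod (p ^ (M + 1)) := (((u₁ : ZMod (p ^ M)).val : ℕ) : ZMod (p ^ (M + 1))) with ha
  have hau : ZMod.castHom (pow_dvd_pow p M.le_succ) (ZMod (p ^ M)) a = (u₁ : ZMod (p ^ M)) := by
    rw [ha, map_natCast, ZMod.natCast_zmod_val]
  set F := Finset.univ.filter (fun b : ZMod (p ^ (M + 2)) ↦
    ZMod.castHom (pow_dvd_pow p (M + 1).le_succ) (ZMod (p ^ (M + 1))) b = a) with hF
  have hconst : ∀ b ∈ F, PadicInt.toZMod (XO b) = c b₁ := by
    intro b hb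
    have hbF := (Finset.mem_filter.mp hb).2
    -- `b = b₁ + t p^{M+1}`
    set d : ZMod (p ^ (M + 2)) := b - (b₁ : ZMod (p ^ (M + 2))) with hd
    have hd0 : ZMod.castHom (pow_dvd_pow p (M + 1).le_succ) (ZMod (p ^ (M + 1))) d = 0 := by
      rw [hd, map_sub, hbF, hb₁val, map_natCast, sub_eq_zero]
    have hdval : p ^ (M + 1) ∣ d.val := by
      rw [ZMod.castHom_apply, ZMod.cast_eq_val] at hd0
      exact (ZMod.natCast_eq_zero_iff _ _).mp hd0
    obtain ⟨t, ht⟩ := hdval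
    obtain ⟨u, hu, hcu⟩ := hfibc t
    have hub : (u : ZMod (p ^ (M + 2))) = b := by
      rw [hu, show M + 2 - 1 = M + 1 by omega]
      have : (b : ZMod (p ^ (M + 2))) = (b₁ : ZMod (p ^ (M + 2))) + d := by rw [hd]; ring
      rw [this, ← ZMod.natCast_zmod_val d, ht]
      push_cast
      ring
    rw [← hcu, hcdef]
    simp only [hub]
  -- the fibre sum vanishes mod `p`
  have hsum0 : PadicInt.toZMod (∑ b ∈ F, XO b) = 0 := by
    rw [map_sum, Finset.sum_congr rfl hconst, Finset.sum_const, hF, card_filter_castHom_eq, nsmul_eq_mul, ZMod.natCast_self, zero_mul]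
  rw [hker, PadicInt.norm_def, PadicInt.coe_sum] at hsum0
  simp only [hXcoe] at hsum0
  rw [← Rat.cast_sum, hF, sum_teichOrbitSum_fibre_eq_neg hp2 hf hgood hap hM1 a, hau, Rat.cast_neg, norm_neg] at hsum0
  exact absurd hu₁ hsum0.ne

/-! ## §3 The reverse valve: a unit orbit sum of `W` gives brick B1 for the partner (with `c = 1`) -/

/-- ★ **The REVERSE valve.** `W/ℚ` elliptic, globally minimal, `p` odd supersingular good (`a_p = 0`), `f` a newform of `W`; a depleted pair
`(f₁, g₁)` on `Γ₀(M₀)` with the OUTPUT clauses of Vatsal's congruence along `ι` (`hVf hVg hVc hVu`) and the Euler-factor family depletion identity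
(`hdep`). If SOME ω⁰-orbit sum of `f` is a `p`-adic unit (`‖S_f(p,m,u)‖ = 1`, `m ≥ 1`) then brick B1 holds for `g₁` with `c = 1`. Proof: §2 gives a
unit DEPLETED orbit sum in the `Ω⁺_f`-normalisation; `‖ι⁻¹(Ωf/Ω⁺_f)‖ ≤ 1` since `[·]⁺_f` is integral at EVERY cusp (`W[p]` irreducible,
`norm_ratPlusSymbol_le_one_of_irreducible`, at Vatsal's unit point); so the canonical `f₁`-orbit sum is a unit, and the congruence moves it to `g₁`.
[cite: Vatsal1999, Thm. (1.13) and Remark (1.12)] [cite: MazurTateTeitelbaum1986Invent, §I.10 (10.1)] -/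
theorem orbitUnitCert_of_norm_teichOrbitSum_eq_one {M₀ : ℕ} (hp2 : p ≠ 2) (hf : IsNewformOf W f) (hgood : W.HasGoodReductionAtPrime p)
    (hap : W.frobeniusTrace p = 0)
    (ι : PadicAlgCl p ≃+* ℂ) (f₁ g₁ : CuspForm (Gamma0 M₀) 2) {Ωf Ωg : ℂ} (hΩf : Ωf ≠ 0)
    (hVf : ∀ x : ℚ, Valued.v (ι.symm (plusSymbol f₁ x / Ωf)) ≤ 1)
    (hVg : ∀ x : ℚ, Valued.v (ι.symm (plusSymbol g₁ x / Ωg)) ≤ 1)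
    (hVc : ∀ x : ℚ, Valued.v (ι.symm (plusSymbol f₁ x / Ωf - plusSymbol g₁ x / Ωg)) < 1)
    (hVu : ∃ x : ℚ, Valued.v (ι.symm (plusSymbol f₁ x / Ωf)) = 1)
    {κ : Type*} [Fintype κ] [DecidableEq κ] (ℓ : κ → ℕ) (hℓ : ∀ i, 1 < ℓ i ∧ ¬ p ∣ ℓ i) (P : κ → ℤ[X]) (hP0 : ∀ i, (P i).coeff 0 = 1)
    (hdep : ∀ x : ℚ, plusSymbol f₁ x = ∑ k ∈ Fintype.piFinset (fun _ : κ ↦ Finset.range 3),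
      (((∏ i, ((P i).coeff (k i) : ℚ) * ((ℓ i : ℚ) ^ (k i))⁻¹ : ℚ) : ℚ) : ℂ) * plusSymbol f (((∏ i, ℓ i ^ (k i) : ℕ) : ℚ) * x))
    {m : ℕ} (hm : 1 ≤ m) (h : ∃ u : (ZMod (p ^ m))ˣ, ‖((teichOrbitSum f p m (u : ZMod (p ^ m)) : ℚ) : ℚ_[p])‖ = 1) :
    ∃ c : PadicAlgCl p, (∀ x : ℚ, ‖c * ι.symm (plusSymbol g₁ x / Ωg)‖ ≤ 1) ∧
      ∃ n : ℕ, 1 ≤ n ∧ ∃ b : (ZMod (p ^ n))ˣ,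
        ‖∑ t ∈ (Finset.univ : Finset (ZMod (p ^ n))).filter (fun t => t ^ (p - 1) = 1),
            c * ι.symm (plusSymbol g₁ ((((t * (b : ZMod (p ^ n))).val : ℕ) : ℚ) / (p : ℚ) ^ n) / Ωg)‖ = 1 := by
  have hp' : p.Prime := Fact.out
  have hf0 : IsNewform0 f := hf.1
  have hQ : coeffField f = ⊥ := hf.coeffField_eq_bot
  have hΩpos : 0 < plusPeriod f := IsNewform0.plusPeriod_pos_holds hf0 hQ
  have hΩ : (plusPeriod f : ℂ) ≠ 0 := by exact_mod_cast hΩpos.ne'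
  have hirr : W.HasIrreducibleModPGaloisRep p :=
    hasIrreducibleModPGaloisRep_of_dvd_frobeniusTrace W p hp2
      (W.not_dvd_minimalDiscriminantInt_of_hasGoodReductionAtPrime' p hgood) (by rw [hap]; exact dvd_zero _)
  -- Vatsal's output in norm currency
  have hvf_le : ∀ x : ℚ, ‖ι.symm (plusSymbol f₁ x / Ωf)‖ ≤ 1 := fun x ↦ (PadicAlgCl.valuation_le_one_iff _).mp (hVf x)
  have hvg_le : ∀ x : ℚ, ‖ι.symm (plusSymbol g₁ x / Ωg)‖ ≤ 1 := fun x ↦ (PadicAlgCl.valuation_le_one_iff _).mp (hVg x)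
  have hvc : ∀ x : ℚ, ‖ι.symm (plusSymbol f₁ x / Ωf) - ι.symm (plusSymbol g₁ x / Ωg)‖ < 1 := fun x ↦ by
    rw [← map_sub, ← coe_nnnorm, ← NNReal.coe_one, NNReal.coe_lt_coe, ← PadicAlgCl.valuation_def]; exact hVc x
  obtain ⟨x₀, hx₀v⟩ := hVu
  have hx₀ : ‖ι.symm (plusSymbol f₁ x₀ / Ωf)‖ = 1 := (PadicAlgCl.valuation_eq_one_iff _).mp hx₀v
  have nrc : ∀ q : ℚ, ‖(q : PadicAlgCl p)‖ = ‖(q : ℚ_[p])‖ := fun q ↦ by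
    rw [← map_ratCast (algebraMap ℚ_[p] (PadicAlgCl p)) q]; exact PadicAlgCl.norm_extends p _
  -- the depleted symbol `D` in the `Ω⁺_f`-normalisation, and `c_f = ι⁻¹(Ωf/Ω⁺_f)`
  have hdepΩ : ∀ x : ℚ, plusSymbol f₁ x =
      ((∑ k ∈ Fintype.piFinset (fun _ : κ ↦ Finset.range 3), (∏ i, ((P i).coeff (k i) : ℚ) * ((ℓ i : ℚ) ^ (k i))⁻¹) *
        ratPlusSymbol f (((∏ i, ℓ i ^ (k i) : ℕ) : ℚ) * x) : ℚ) : ℂ) * (plusPeriod f : ℂ) := by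
    intro x
    rw [hdep x, Rat.cast_sum, Finset.sum_mul]
    refine Finset.sum_congr rfl fun k _ ↦ ?_
    rw [Rat.cast_mul, mul_assoc, ratCast_ratPlusSymbol_mul_plusPeriod f hf0 hQ (((∏ i, ℓ i ^ (k i) : ℕ) : ℚ) * x)]
  have hcfv : ∀ x : ℚ, ι.symm (Ωf / (plusPeriod f : ℂ)) * ι.symm (plusSymbol f₁ x / Ωf) =
      ((∑ k ∈ Fintype.piFinset (fun _ : κ ↦ Finset.range 3), (∏ i, ((P i).coeff (k i) : ℚ) * ((ℓ i : ℚ) ^ (k i))⁻¹) *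
        ratPlusSymbol f (((∏ i, ℓ i ^ (k i) : ℕ) : ℚ) * x) : ℚ) : PadicAlgCl p) := by
    intro x
    rw [← map_mul, ← map_ratCast ι.symm]
    congr 1
    rw [hdepΩ x]
    set d : ℚ := ∑ k ∈ Fintype.piFinset (fun _ : κ ↦ Finset.range 3), (∏ i, ((P i).coeff (k i) : ℚ) * ((ℓ i : ℚ) ^ (k i))⁻¹) *
      ratPlusSymbol f (((∏ i, ℓ i ^ (k i) : ℕ) : ℚ) * x)
    field_simp
  -- `D` is integral at EVERY cusp (`W[p]` irreducible), hence `‖c_f‖ ≤ 1`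
  have hcoef : ∀ k : κ → ℕ, ‖(((∏ i, ((P i).coeff (k i) : ℚ) * ((ℓ i : ℚ) ^ (k i))⁻¹ : ℚ) : ℚ) : ℚ_[p])‖ ≤ 1 := by
    intro k
    rw [Rat.cast_prod, norm_prod]
    refine Finset.prod_le_one (fun i _ ↦ norm_nonneg _) fun i _ ↦ ?_
    have hℓ1 : ‖((ℓ i : ℕ) : ℚ_[p])‖ = 1 :=
      Padic.norm_natCast_eq_one_iff.mpr ((Nat.Prime.coprime_iff_not_dvd hp').mpr (hℓ i).2)
    rw [Rat.cast_mul, Rat.cast_inv, Rat.cast_pow, Rat.cast_natCast, Rat.cast_intCast, norm_mul, norm_inv, norm_pow, hℓ1, one_pow,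
      inv_one, mul_one]
    exact Padic.norm_int_le_one _
  have hDint : ∀ x : ℚ, ‖((∑ k ∈ Fintype.piFinset (fun _ : κ ↦ Finset.range 3), (∏ i, ((P i).coeff (k i) : ℚ) * ((ℓ i : ℚ) ^ (k i))⁻¹) *
        ratPlusSymbol f (((∏ i, ℓ i ^ (k i) : ℕ) : ℚ) * x) : ℚ) : ℚ_[p])‖ ≤ 1 := by
    intro x
    rw [Rat.cast_sum]
    refine IsUltrametricDist.norm_sum_le_of_forall_le_of_nonneg zero_le_one fun k _ ↦ ?_
    rw [Rat.cast_mul, norm_mul]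
    exact mul_le_one₀ (hcoef k) (norm_nonneg _)
      (Summit.BirchSwinnertonDyer.Rank1Residual.Additive.norm_ratPlusSymbol_le_one_of_irreducible hp2 hf hirr _)
  have hcf1 : ‖ι.symm (Ωf / (plusPeriod f : ℂ))‖ ≤ 1 := by
    have h1 : ‖ι.symm (Ωf / (plusPeriod f : ℂ)) * ι.symm (plusSymbol f₁ x₀ / Ωf)‖ ≤ 1 := by rw [hcfv, nrc]; exact hDint x₀
    rwa [norm_mul, hx₀, mul_one] at h1
  -- §2: a unit DEPLETED orbit sum of `f` (Ω⁺_f-normalisation)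
  obtain ⟨n, hn, b, hunit⟩ := exists_norm_depletedOrbitSum_eq_one hp2 hf hgood hap ℓ hℓ P hP0 hm h
  -- un-swap: the depleted orbit sum is the orbit sum of `D`
  have hswap : (∑ t ∈ (Finset.univ : Finset (ZMod (p ^ n))).filter (fun t => t ^ (p - 1) = 1),
      ∑ k ∈ Fintype.piFinset (fun _ : κ ↦ Finset.range 3), (∏ i, ((P i).coeff (k i) : ℚ) * ((ℓ i : ℚ) ^ (k i))⁻¹) *
        ratPlusSymbol f (((∏ i, ℓ i ^ (k i) : ℕ) : ℚ) * ((((t * (b : ZMod (p ^ n))).val : ℕ) : ℚ) / (p : ℚ) ^ n)) : ℚ) =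
      ∑ k ∈ Fintype.piFinset (fun _ : κ ↦ Finset.range 3), (∏ i, ((P i).coeff (k i) : ℚ) * ((ℓ i : ℚ) ^ (k i))⁻¹) *
        teichOrbitSum f p n (((∏ i, ℓ i ^ (k i) : ℕ) : ZMod (p ^ n)) * (b : ZMod (p ^ n))) := by
    rw [Finset.sum_comm]
    refine Finset.sum_congr rfl fun k _ ↦ ?_
    rw [← Finset.mul_sum, sum_ratPlusSymbol_mul_eq_teichOrbitSum]
  rw [← hswap] at hunit
  -- in `ℚ̄_p`: the orbit sum of `D` is `c_f ·` (orbit sum of `ι⁻¹(φ_{f₁}/Ωf)`)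
  set Sf := ∑ t ∈ (Finset.univ : Finset (ZMod (p ^ n))).filter (fun t => t ^ (p - 1) = 1),
    ι.symm (plusSymbol f₁ ((((t * (b : ZMod (p ^ n))).val : ℕ) : ℚ) / (p : ℚ) ^ n) / Ωf) with hSf
  have hSf_le : ‖Sf‖ ≤ 1 := IsUltrametricDist.norm_sum_le_of_forall_le_of_nonneg zero_le_one fun t _ ↦ hvf_le _
  have hprodnorm : ‖ι.symm (Ωf / (plusPeriod f : ℂ))‖ * ‖Sf‖ = 1 := by
    rw [← norm_mul, hSf, Finset.mul_sum, Finset.sum_congr rfl fun t _ ↦ hcfv _, ← Rat.cast_sum, nrc]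
    exact hunit
  have hSf1 : ‖Sf‖ = 1 := by
    nlinarith [norm_nonneg (ι.symm (Ωf / (plusPeriod f : ℂ))), norm_nonneg Sf]
  -- congruence moves the unit orbit sum to `g₁`
  set Sg := ∑ t ∈ (Finset.univ : Finset (ZMod (p ^ n))).filter (fun t => t ^ (p - 1) = 1),
    ι.symm (plusSymbol g₁ ((((t * (b : ZMod (p ^ n))).val : ℕ) : ℚ) / (p : ℚ) ^ n) / Ωg) with hSg
  have hSg1 : ‖Sg‖ = 1 :=
    norm_eq_one_of_norm_sub_lt_one hSf1 (norm_sum_sub_sum_lt_one _ _ _ fun t _ ↦ hvc _)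
      (IsUltrametricDist.norm_sum_le_of_forall_le_of_nonneg zero_le_one fun t _ ↦ hvg_le _)
  exact ⟨1, fun x ↦ by rw [one_mul]; exact hvg_le x, n, hn, b, by simp only [one_mul]; exact hSg1⟩

end Summit.BirchSwinnertonDyer.BirchSwinnertonDyer.Theorems.SmallImageValve

end
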